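import Literature.NumberTheory.EllipticCurves.Kato2004.IwasawaCohomologyNumberFieldTwistModel
import HarnessLib

/-!
# The coefficient change `u_* : H¹(V, T_pA) → H¹(V, T_pW)` along a `ℤ_p`-isomorphism `u : T_pA ≃ T_pW` that is
# equivariant on the subgroup `V ≤ Gal(ℚ̄/ℚ)` (any `V`; e.g. `V = Gal(ℚ̄/ℚ(μ_m))` for the quadratic twist `A = W^{(d)}`,
# `√d ∈ ℚ(μ_m)`): definition, cocycle formula, integrality, compatibility with corestriction and with the action of
# every `g` on which `u` is equivariant

Topic `NumberTheory/EllipticCurves`, sub-directory `Kato2004` (namespace = path). Cell `bsd-2adic`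
(run/shared/lean/pub/bsd-2adic/), seat `bsd-2adic-addL2x` GEN 21 (crux stmt-BirchSwinnertonDyer-19098
`AdditiveRankZeroAtTwo`, child C4″ stmt-BirchSwinnertonDyer-22618; reading step T22 (b) of the descent sockets, ODD-BRANCH
side). The file `IwasawaCohomologyNumberFieldTwistModel` (seat `bsd-2adic-conv-1` GEN 30) defines the same coefficient change
`layerTwist` on the SPECIFIC subgroups `layerGalRange K κ n` of its `K`-carrier vocabulary; the odd-branch transport of Kato's
zeta elements of `f_{W^{(−1)}}` needs it on the Euler-system LEVELS `Gal(ℚ̄/ℚ(μ_{2^k}))` (`EulerSystemValues.cycSubgroup`),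
so we record the construction for an ARBITRARY subgroup `V` on which `u` is equivariant (hypothesis `hV`). Definitions with
bodies (`twistRepHomOn`, `twistH1On`) and theorems; no named fact, no instance, no notation; nothing about any curve is
asserted; BSD is not advanced.

* `twistRepHomOn u hu hV` — the `V`-equivariant coefficient map as a morphism `T_pA|_V ⟶ T_pW|_V`;
* `twistH1On u hu hV : H¹(V, T_pA) ⟶ H¹(V, T_pW)` — `cohomologyMap` of it.
The cocycle formula `[φ] ↦ [u ∘ φ]`, integrality, and the compatibilities with corestriction and with the Galois action are
the theorems of the companion `H1CoefficientChangeProofs.lean` (this file: the two definitions only).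

References: J.-P. Serre, *Galois Cohomology* (1997), I §2.4 (functoriality in the coefficients) [SerreGaloisCohomology1997];
J. Neukirch, A. Schmidt, K. Wingberg, *Cohomology of Number Fields* (2008), I §5 Prop. 1.5.4 (compatible pairs)
[NeukirchSchmidtWingberg2008]; K. Kato, Astérisque 295 (2004) §8.2 (integral classes) [Kato2004Asterisque]; K. Rubin,
*Euler Systems* (2000), Ch. II §4 and Ch. VI (twisting by characters) [Rubin2000].
-/

noncomputable section

open scoped NumberField Pointwise
open CategoryTheory Field IsDedekindDomain
open Literature.NumberTheory.GaloisRepresentations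
open Literature.NumberTheory.EllipticCurves (subgroupInclusion subgroupInclusion_apply_coe)
open Literature.NumberTheory.EllipticCurves.Kato2004.EulerSystemValues (tateRep)

namespace Literature.NumberTheory.EllipticCurves.Kato2004

section CoefficientChange

variable {p : ℕ} [Fact p.Prime]
  (W : WeierstrassCurve ℚ) [W.IsElliptic] [ContinuousSMul ℤ_[p] (W.tateModule p)]
  (A' : WeierstrassCurve ℚ) [A'.IsElliptic] [ContinuousSMul ℤ_[p] (A'.tateModule p)]
  (u : A'.tateModule p ≃ₗ[ℤ_[p]] W.tateModule p) (hu : Continuous u)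
  {V : Subgroup (absoluteGaloisGroup ℚ)}
  (hV : ∀ σ : absoluteGaloisGroup ℚ, σ ∈ V → ∀ x : A'.tateModule p, u (σ • x) = σ • u x)

/-- The `V`-equivariant coefficient map `u : T_pA|_V ⟶ T_pW|_V` as a morphism of topological representations of `V`
(the subgroup `V` being one on which `u` intertwines the two Galois actions). [cite: SerreGaloisCohomology1997, I §2.4] -/
def twistRepHomOn : subgroupRep (tateRep A' p).toTopRep V ⟶ subgroupRep (tateRep W p).toTopRep V :=
  TopRep.ofHom ⟨⟨u.toLinearMap, hu⟩, fun g => ContinuousLinearMap.ext fun x => hV (g : absoluteGaloisGroup ℚ) g.2 x⟩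

/-- The coefficient map of `twistRepHomOn` is `u`. [cite: SerreGaloisCohomology1997, I §2.4] -/
theorem twistRepHomOn_hom_apply (x : A'.tateModule p) : (twistRepHomOn W A' u hu hV).hom x = u x := rfl

/-- **`u_* : H¹(V, T_pA) ⟶ H¹(V, T_pW)`**, the coefficient change along `u` (functoriality of `H¹` in the
coefficients, for the `V`-equivariant map `u`). [cite: SerreGaloisCohomology1997, I §2.4] -/
def twistH1On : H1 (tateRep A' p) V ⟶ H1 (tateRep W p) V :=
  cohomologyMap (twistRepHomOn W A' u hu hV) 1

end CoefficientChange

end Literature.NumberTheory.EllipticCurves.Kato2004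

end
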